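import Mathlib.Data.Fin.Tuple.Basic
import Mathlib.Algebra.BigOperators.Fin
import Mathlib.Data.Fintype.BigOperators
import Mathlib.Tactic.Ring
import HarnessLib

/-!
# DGIJL Prop. 4.12 by explicit tableaux, VII: sums over injective maps (inclusion–exclusion)

Topic `Literature/Computability/AlgebraicComplexity`; generic plumbing (no named facts). The closed
forms `T·.aeval_eq` of the certificate for

* Dutta–Gesmundo–Ikenmeyer–Jindal–Lysikov, arXiv:2211.07055, **Prop. 4.12**

(`DGIJLLiftingStruct*.lean`) end in a sum over the INJECTIVE class-value maps `v : Fin c → Fin N`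
of a product of one-coordinate factors `Π_i f_i (v i)`. This file evaluates such sums by
inclusion–exclusion on the power sums `Σ_x f_i(x) f_j(x) ⋯`: the recursion `sum_inj_cons`
(peel the first coordinate: the new value avoids the old ones) and the closed forms for two, three
and four coordinates (`sum_inj_two`, `sum_inj_three`, `sum_inj_four`). Honest framing: elementary
finite combinatorics; nothing here bears on VP versus VNP.
-/

open scoped BigOperators

namespace Literature.Computability.AlgebraicComplexity

namespace DGIJLLift

variable {α R : Type*} [Fintype α] [DecidableEq α] [CommRing R]

/-- **Peeling the first coordinate of an injective map**: the new value ranges over the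
complement of the old ones, so `Σ_(v inj) f(v 0) Φ(tail v) = Σ_(u inj) Φ(u) (Σ_x f x - Σ_j f(u j))`.
[cite: DuttaGesmundoIkenmeyerJindalLysikovJSC2025, Prop. 4.12] -/
theorem sum_inj_cons {n : ℕ} (f : α → R) (Φ : (Fin n → α) → R) :
    (∑ v : Fin (n + 1) → α, if Function.Injective v then f (v 0) * Φ (Fin.tail v) else 0) =
      ∑ u : Fin n → α,
        if Function.Injective u then Φ u * ((∑ x, f x) - ∑ j, f (u j)) else 0 := by
  rw [← Fintype.sum_equiv (Fin.consEquiv fun _ => α)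
      (fun p : α × (Fin n → α) =>
        if Function.Injective (Fin.cons p.1 p.2 : Fin (n + 1) → α) then f p.1 * Φ p.2 else 0)
      _ (fun p => by
        show _ = if Function.Injective (Fin.cons p.1 p.2 : Fin (n + 1) → α) then
          f ((Fin.cons p.1 p.2 : Fin (n + 1) → α) 0) * Φ (Fin.tail (Fin.cons p.1 p.2 : Fin (n + 1) → α))
          else 0
        rw [Fin.cons_zero, Fin.tail_cons])]
  rw [Fintype.sum_prod_type_right]
  refine Finset.sum_congr rfl fun u _ => ?_
  by_cases hu : Function.Injective u
  · rw [if_pos hu]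
    have hfilt : ∀ x : α, (if Function.Injective (Fin.cons x u : Fin (n + 1) → α) then f x * Φ u else 0)
        = f x * Φ u - if x ∈ Finset.univ.image u then f x * Φ u else 0 := by
      intro x
      by_cases hx : x ∈ Finset.univ.image u
      · rw [if_pos hx, if_neg, sub_self]
        rw [Fin.cons_injective_iff, not_and_or]
        left
        obtain ⟨j, -, hj⟩ := Finset.mem_image.mp hx
        exact fun h => h ⟨j, hj⟩
      · rw [if_neg hx, if_pos, sub_zero]
        rw [Fin.cons_injective_iff]
        refine ⟨?_, hu⟩
        rintro ⟨j, hj⟩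
        exact hx (Finset.mem_image.mpr ⟨j, Finset.mem_univ _, hj⟩)
    rw [Finset.sum_congr rfl fun x _ => hfilt x, Finset.sum_sub_distrib, Finset.sum_ite_mem,
      Finset.univ_inter, Finset.sum_image fun j _ j' _ h => hu h, ← Finset.sum_mul, ← Finset.sum_mul]
    ring
  · rw [if_neg hu]
    refine Finset.sum_eq_zero fun x _ => ?_
    rw [if_neg]
    rw [Fin.cons_injective_iff, not_and_or]
    exact Or.inr hu

/-- Every map out of `Fin 0` is injective: the base of the recursion.
[cite: DuttaGesmundoIkenmeyerJindalLysikovJSC2025, Prop. 4.12] -/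
theorem sum_inj_zero (Φ : (Fin 0 → α) → R) :
    (∑ u : Fin 0 → α, if Function.Injective u then Φ u else 0) = Φ Fin.elim0 := by
  rw [Fintype.sum_unique]
  have hinj : Function.Injective (default : Fin 0 → α) := fun i => Fin.elim0 i
  rw [if_pos hinj, Subsingleton.elim (default : Fin 0 → α) Fin.elim0]

/-- **One coordinate**: `Σ_(v : Fin 1 → α, inj) f(v 0) = Σ_x f x`.
[cite: DuttaGesmundoIkenmeyerJindalLysikovJSC2025, Prop. 4.12] -/
theorem sum_inj_one (f : α → R) :
    (∑ v : Fin 1 → α, if Function.Injective v then f (v 0) else 0) = ∑ x, f x := by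
  have h := sum_inj_cons (n := 0) f (fun _ => 1)
  simp only [mul_one, Finset.univ_eq_empty, Finset.sum_empty, sub_zero, one_mul] at h
  rw [h, sum_inj_zero]

/-- **Two coordinates**: `Σ_(v inj) f(v 0) g(v 1) = (Σ f)(Σ g) - Σ f g`.
[cite: DuttaGesmundoIkenmeyerJindalLysikovJSC2025, Prop. 4.12] -/
theorem sum_inj_two (f g : α → R) :
    (∑ v : Fin 2 → α, if Function.Injective v then f (v 0) * g (v 1) else 0) =
      (∑ x, f x) * (∑ x, g x) - ∑ x, f x * g x := by
  have h := sum_inj_cons (n := 1) f (fun u => g (u 0))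
  have e : (∑ v : Fin 2 → α, if Function.Injective v then f (v 0) * g (v 1) else 0) =
      ∑ v : Fin 2 → α, if Function.Injective v then f (v 0) * (fun u : Fin 1 → α => g (u 0)) (Fin.tail v)
        else 0 := Finset.sum_congr rfl fun v _ => rfl
  rw [e, h]
  have e2 : (∑ u : Fin 1 → α, if Function.Injective u then g (u 0) * ((∑ x, f x) - ∑ j, f (u j)) else 0) =
      ∑ u : Fin 1 → α, if Function.Injective u then (fun x => g x * ((∑ y, f y) - f x)) (u 0) else 0 :=
    Finset.sum_congr rfl fun u _ => by simp only [Fin.sum_univ_one]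
  rw [e2, sum_inj_one (fun x => g x * ((∑ y, f y) - f x))]
  simp only [mul_sub, Finset.sum_sub_distrib, ← Finset.sum_mul]
  rw [Finset.sum_congr rfl fun x _ => mul_comm (g x) (f x)]
  ring

/-- **Three coordinates** (inclusion–exclusion):
`Σ_(v inj) f(v 0) g(v 1) h(v 2) = FGH - (Σfg)H - (Σfh)G - (Σgh)F + 2Σfgh`.
[cite: DuttaGesmundoIkenmeyerJindalLysikovJSC2025, Prop. 4.12] -/
theorem sum_inj_three (f g h : α → R) :
    (∑ v : Fin 3 → α, if Function.Injective v then f (v 0) * g (v 1) * h (v 2) else 0) =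
      (∑ x, f x) * (∑ x, g x) * (∑ x, h x) - (∑ x, f x * g x) * (∑ x, h x)
        - (∑ x, f x * h x) * (∑ x, g x) - (∑ x, g x * h x) * (∑ x, f x)
        + 2 * ∑ x, f x * g x * h x := by
  have hc := sum_inj_cons (n := 2) f (fun u => g (u 0) * h (u 1))
  have e : (∑ v : Fin 3 → α, if Function.Injective v then f (v 0) * g (v 1) * h (v 2) else 0) =
      ∑ v : Fin 3 → α, if Function.Injective v then
        f (v 0) * (fun u : Fin 2 → α => g (u 0) * h (u 1)) (Fin.tail v) else 0 :=
    Finset.sum_congr rfl fun v _ => by split_ifs <;> simp only [Fin.tail, Fin.succ_zero_eq_one,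
      Fin.succ_one_eq_two, mul_assoc]
  rw [e, hc]
  have e2 : ∀ u : Fin 2 → α,
      (if Function.Injective u then g (u 0) * h (u 1) * ((∑ x, f x) - ∑ j, f (u j)) else 0) =
        (∑ x, f x) * (if Function.Injective u then g (u 0) * h (u 1) else 0)
          - (if Function.Injective u then (fun x => g x * f x) (u 0) * h (u 1) else 0)
          - (if Function.Injective u then g (u 0) * (fun x => h x * f x) (u 1) else 0) := by
    intro u
    rw [Fin.sum_univ_two]
    split_ifs <;> ring
  rw [Finset.sum_congr rfl fun u _ => e2 u, Finset.sum_sub_distrib, Finset.sum_sub_distrib,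
    ← Finset.mul_sum, sum_inj_two g h, sum_inj_two (fun x => g x * f x) h,
    sum_inj_two g (fun x => h x * f x)]
  have c1 : ∑ x, g x * f x = ∑ x, f x * g x := Finset.sum_congr rfl fun x _ => mul_comm _ _
  have c2 : ∑ x, h x * f x = ∑ x, f x * h x := Finset.sum_congr rfl fun x _ => mul_comm _ _
  have c3 : ∑ x, g x * f x * h x = ∑ x, f x * g x * h x :=
    Finset.sum_congr rfl fun x _ => by ring
  have c4 : ∑ x, g x * (h x * f x) = ∑ x, f x * g x * h x :=
    Finset.sum_congr rfl fun x _ => by ring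
  rw [c1, c2, c3, c4]
  ring

/-- **Four coordinates** (inclusion–exclusion over the set partitions of four points).
[cite: DuttaGesmundoIkenmeyerJindalLysikovJSC2025, Prop. 4.12] -/
theorem sum_inj_four (f g h w : α → R) :
    (∑ v : Fin 4 → α, if Function.Injective v then f (v 0) * g (v 1) * h (v 2) * w (v 3) else 0) =
      (∑ x, f x) * (∑ x, g x) * (∑ x, h x) * (∑ x, w x)
        - (∑ x, f x * g x) * (∑ x, h x) * (∑ x, w x) - (∑ x, f x * h x) * (∑ x, g x) * (∑ x, w x)
        - (∑ x, f x * w x) * (∑ x, g x) * (∑ x, h x) - (∑ x, g x * h x) * (∑ x, f x) * (∑ x, w x)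
        - (∑ x, g x * w x) * (∑ x, f x) * (∑ x, h x) - (∑ x, h x * w x) * (∑ x, f x) * (∑ x, g x)
        + 2 * ((∑ x, f x * g x * h x) * (∑ x, w x) + (∑ x, f x * g x * w x) * (∑ x, h x)
          + (∑ x, f x * h x * w x) * (∑ x, g x) + (∑ x, g x * h x * w x) * (∑ x, f x))
        + ((∑ x, f x * g x) * (∑ x, h x * w x) + (∑ x, f x * h x) * (∑ x, g x * w x)
          + (∑ x, f x * w x) * (∑ x, g x * h x))
        - 6 * ∑ x, f x * g x * h x * w x := by
  have hc := sum_inj_cons (n := 3) f (fun u => g (u 0) * h (u 1) * w (u 2))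
  have e : (∑ v : Fin 4 → α,
      if Function.Injective v then f (v 0) * g (v 1) * h (v 2) * w (v 3) else 0) =
      ∑ v : Fin 4 → α, if Function.Injective v then
        f (v 0) * (fun u : Fin 3 → α => g (u 0) * h (u 1) * w (u 2)) (Fin.tail v) else 0 :=
    Finset.sum_congr rfl fun v _ => by
      split_ifs
      · show f (v 0) * g (v 1) * h (v 2) * w (v 3) = f (v 0) * (g (v 1) * h (v 2) * w (v 3)); ring
      · rfl
  rw [e, hc]
  have e2 : ∀ u : Fin 3 → α,
      (if Function.Injective u then g (u 0) * h (u 1) * w (u 2) * ((∑ x, f x) - ∑ j, f (u j)) else 0) =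
        (∑ x, f x) * (if Function.Injective u then g (u 0) * h (u 1) * w (u 2) else 0)
          - (if Function.Injective u then (fun x => g x * f x) (u 0) * h (u 1) * w (u 2) else 0)
          - (if Function.Injective u then g (u 0) * (fun x => h x * f x) (u 1) * w (u 2) else 0)
          - (if Function.Injective u then g (u 0) * h (u 1) * (fun x => w x * f x) (u 2) else 0) := by
    intro u
    rw [Fin.sum_univ_three]
    split_ifs <;> ring
  rw [Finset.sum_congr rfl fun u _ => e2 u, Finset.sum_sub_distrib, Finset.sum_sub_distrib,
    Finset.sum_sub_distrib, ← Finset.mul_sum, sum_inj_three g h w,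
    sum_inj_three (fun x => g x * f x) h w, sum_inj_three g (fun x => h x * f x) w,
    sum_inj_three g h (fun x => w x * f x)]
  have c1 : ∑ x, g x * f x = ∑ x, f x * g x := Finset.sum_congr rfl fun x _ => mul_comm _ _
  have c2 : ∑ x, h x * f x = ∑ x, f x * h x := Finset.sum_congr rfl fun x _ => mul_comm _ _
  have c3 : ∑ x, w x * f x = ∑ x, f x * w x := Finset.sum_congr rfl fun x _ => mul_comm _ _
  have c4 : ∑ x, g x * f x * h x = ∑ x, f x * g x * h x := Finset.sum_congr rfl fun x _ => by ring
  have c5 : ∑ x, g x * f x * w x = ∑ x, f x * g x * w x := Finset.sum_congr rfl fun x _ => by ring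
  have c6 : ∑ x, g x * (h x * f x) = ∑ x, f x * g x * h x := Finset.sum_congr rfl fun x _ => by ring
  have c7 : ∑ x, h x * f x * w x = ∑ x, f x * h x * w x := Finset.sum_congr rfl fun x _ => by ring
  have c8 : ∑ x, g x * (w x * f x) = ∑ x, f x * g x * w x := Finset.sum_congr rfl fun x _ => by ring
  have c9 : ∑ x, h x * (w x * f x) = ∑ x, f x * h x * w x := Finset.sum_congr rfl fun x _ => by ring
  have c10 : ∑ x, g x * f x * h x * w x = ∑ x, f x * g x * h x * w x :=
    Finset.sum_congr rfl fun x _ => by ring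
  have c11 : ∑ x, g x * (h x * f x) * w x = ∑ x, f x * g x * h x * w x :=
    Finset.sum_congr rfl fun x _ => by ring
  have c12 : ∑ x, g x * h x * (w x * f x) = ∑ x, f x * g x * h x * w x :=
    Finset.sum_congr rfl fun x _ => by ring
  rw [c1, c2, c3, c4, c5, c6, c7, c8, c9, c10, c11, c12]
  ring

end DGIJLLift

end Literature.Computability.AlgebraicComplexity
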